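import Summits.CriticalPhenomena.PercolationContinuityZ3.Theorems.PercNearOneGluingNoHeavyLowerTailFourCopyHubSoundA
import HarnessLib

/-! — part 2: per-program bounds at the real states, the hub bound, the fibre bound
# `NoHeavyLowerTail` (stmt-CriticalPhenomena-4575) — FOUR-copy switching certificates, IV: SOUNDNESS of the hub checker —
# the real value of a certificate is bounded by the kernel's row value at the real hub state

Support file (prover prim-ineq-prove-3 gen 8; `--supports stmt-CriticalPhenomena-4575`).  No named facts, no sorries.

For a well-formed bounded certificate `c` (`Cert.ok`), a finite graph, a placement `τ` of the four terminals and a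
four-tuple `x` of configurations with types `πX, t₁, t₂, t₃` and real projected hub state `s₃`:
`Sreal c τ x ≤ candT c πX t₁ t₂ t₃ s₃` (`Sreal_le_candT`).  Steps: (1) every program's value is at most the best value
over the admissible output classes at the real avoidance options (parts I–II); (2) regrouping the programs by
(side copy, block of the side root); (3) the stored tables of part III encode these best values with the offset `OFF`,
sums of packed vectors are read digitwise (part III-a), and the kernel's maximum over the option positions dominates the
digit at the real option.  With `piCheck` (every row entry `≤ B`) this gives `Sreal ≤ B(types)` (`Sreal_le_of_piCheck`).
-/

noncomputable section

namespace Summit.CriticalPhenomena.PercolationContinuityZ3.Theorems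

namespace FourCopyHub

open Finset Literature.Probability.Percolation Literature.Probability.Percolation.DecisionTree
open Literature.Probability.Percolation.Gladkov ThreePointLB GroupThreePointLB FourPointAtoms SwitchRelax
open scoped Classical

/-! ### Per-program bounds at the real projected states -/

section Real

variable {V : Type*} [Fintype V] [DecidableEq V] (τ : Fin 4 → V) (c : Cert) (x : Fin 4 → Finset (Sym2 V))

/-- The real projected refined state of copy `j` (source `x 0`). [this work] -/
def st (j : Fin 4) : St4 := proj (ftype τ (x 0)) (realSt4 τ (x 0) (x j))

/-- The real options are relevant. [this work] -/
theorem relB_st (j u : Fin 4) : relB (ftype τ (x 0)) u (st τ x j (rep (ftype τ (x 0)) u)) = true := by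
  rw [st, proj_rep, realSt4_rep]
  have h := okLocal_real τ (x 0) (x j) [] {u}
  simp only [okLocal, Bool.and_eq_true] at h
  exact h.1.2

/-- The real option of a letter lies in the listed options `optsF`. [this work] -/
theorem st_mem_optsF (j w : Fin 4) : st τ x j w ∈ optsF (ftype τ (x 0)) (ftype τ (x j)) w := by
  unfold st proj optsF
  by_cases hw : free (ftype τ (x 0)) w = true
  · rw [if_pos hw, if_pos hw]; exact realP_mem_opts τ (x 0) (x j) w
  · rw [if_neg hw, if_neg hw]; exact List.mem_singleton.2 rfl

/-- The program of a well-formed one-step program is well formed. [this work] -/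
theorem P1.prog_wf {q : P1} (h : q.wf = true) : q.prog.wf = true := by
  rw [P1.wf, decide_eq_true_iff] at h
  rw [Prog.wf_iff]; exact ⟨h, fun h2 => absurd h2 (by simp [P1.prog])⟩

/-- The program of a weakly well-formed two-step program is well formed. [this work] -/
theorem P2.prog_wf {q : P2} (h : q.wfT = true) : q.prog.wf = true := by
  rw [P2.wfT, decide_eq_true_iff] at h
  rw [Prog.wf_iff]; exact ⟨h.1, fun _ => ⟨h.2.1, h.2.2⟩⟩

/-- The arguments of a one-step program's potential other than the output class are read on idle copies. [this work] -/
theorem P1.idle_ne (T : Fin 4) (hT0 : T ≠ 0) (hT3 : T ≠ 3) : oth T ≠ 0 ∧ T ≠ oth T := by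
  revert T; decide

/-- A well-formed two-step program is weakly well formed. [this work] -/
theorem P2.wfT_of_wf {q : P2} (hq : q.wf = true) : q.wfT = true := by
  rw [P2.wf, decide_eq_true_iff] at hq
  rw [P2.wfT, decide_eq_true_iff]; exact ⟨hq.1, hq.2.1, hq.2.2.1⟩

/-- A well-formed certificate is weakly well formed. [this work] -/
theorem Cert.wfT_of_wf {c : Cert} (h : c.wf = true) : c.wfT = true := by
  simp only [Cert.wf, Cert.wfT, Bool.and_eq_true, List.all_eq_true] at h ⊢
  exact ⟨h.1, fun q hq => P2.wfT_of_wf (h.2 q hq)⟩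

/-- The idle copy of a weakly well-formed two-step program is neither the source nor a target. [this work] -/
theorem P2.idl_ne {q : P2} (hq : q.wfT = true) : q.idl ≠ 0 ∧ q.T1 ≠ q.idl ∧ q.T2 ≠ q.idl := by
  rw [P2.wfT, decide_eq_true_iff] at hq
  have key : ∀ T1 T2 : Fin 4, T1 ≠ 0 → T2 ≠ 0 → T2 ≠ T1 →
      (if T1 ≠ 1 ∧ T2 ≠ 1 then (1 : Fin 4) else if T1 ≠ 2 ∧ T2 ≠ 2 then 2 else 3) ≠ 0 ∧
      T1 ≠ (if T1 ≠ 1 ∧ T2 ≠ 1 then (1 : Fin 4) else if T1 ≠ 2 ∧ T2 ≠ 2 then 2 else 3) ∧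
      T2 ≠ (if T1 ≠ 1 ∧ T2 ≠ 1 then (1 : Fin 4) else if T1 ≠ 2 ∧ T2 ≠ 2 then 2 else 3) := by decide
  exact key q.T1 q.T2 hq.1 hq.2.1 hq.2.2

/-- Idle copy of a side-first hub program. [this work] -/
theorem P2.idl_sf {q : P2} {T : Fin 4} (hT1 : q.T1 = T) (hT2 : q.T2 = 3) (hT3 : T ≠ 3) : q.idl = oth T := by
  have key : ∀ T : Fin 4, T ≠ 3 →
      (if T ≠ 1 ∧ (3 : Fin 4) ≠ 1 then (1 : Fin 4) else if T ≠ 2 ∧ (3 : Fin 4) ≠ 2 then 2 else 3) = oth T := by decide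
  rw [P2.idl, hT1, hT2]; exact key T hT3

/-- Idle copy of a hub-first program. [this work] -/
theorem P2.idl_hf {q : P2} {T : Fin 4} (hT1 : q.T1 = 3) (hT2 : q.T2 = T) (hT3 : T ≠ 3) : q.idl = oth T := by
  have key : ∀ T : Fin 4, T ≠ 3 →
      (if (3 : Fin 4) ≠ 1 ∧ T ≠ 1 then (1 : Fin 4) else if (3 : Fin 4) ≠ 2 ∧ T ≠ 2 then 2 else 3) = oth T := by decide
  rw [P2.idl, hT1, hT2]; exact key T hT3

/-- **One-step programs**: the real value is at most `e1` at the real option of the target copy and the classes read on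
the (unchanged) idle copies. [this work] -/
theorem P1.val_le {q : P1} (hq : q.wf = true) :
    q.val τ c x ≤ e1 c (ftype τ (x 0)) q (st τ x q.T (rep (ftype τ (x 0)) q.u))
      (if q.T = 3 then c.cls (ftype τ (x 1)) else c.cls2 (ftype τ (x (oth q.T))))
      (if q.T = 3 then c.cls (ftype τ (x 2)) else c.cls (ftype τ (x 3))) := by
  have hT0 : q.T ≠ 0 := by rw [P1.wf, decide_eq_true_iff] at hq; exact hq
  have hout : q.prog.out τ x q.T = splice (touch (clS (x 0) (roots τ {q.u}))) (x 0) (x q.T) :=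
    Prog.out_first τ x (P1.prog_wf hq)
  have hmem : c.cls (ftype τ (q.prog.out τ x q.T)) ∈ cleanC c (ftype τ (x 0)) q.u (st τ x q.T (rep (ftype τ (x 0)) q.u)) := by
    unfold cleanC
    refine List.mem_dedup.2 (List.mem_map.2 ⟨_, ?_, rfl⟩)
    rw [hout]
    exact ftype_first_mem_cleanL τ (x 0) (x q.T) q.u
  unfold P1.val P1.ev e1
  by_cases hT : q.T = 3
  · have h1 : q.prog.out τ x 1 = x 1 := Prog.out_of_one τ x rfl (by decide) (by show q.T ≠ 1; rw [hT]; decide)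
    have h2 : q.prog.out τ x 2 = x 2 := Prog.out_of_one τ x rfl (by decide) (by show q.T ≠ 2; rw [hT]; decide)
    simp only [hT, if_true, h1, h2]
    rw [hT] at hmem
    exact le_lmax (List.mem_map.2 ⟨_, hmem, rfl⟩)
  · have hne := P1.idle_ne q.T hT0 hT
    have h1 : q.prog.out τ x (oth q.T) = x (oth q.T) := Prog.out_of_one τ x rfl hne.1 hne.2
    have h2 : q.prog.out τ x 3 = x 3 := Prog.out_of_one τ x rfl (by decide) hT
    simp only [hT, if_false, h1, h2]
    exact le_lmax (List.mem_map.2 ⟨_, hmem, rfl⟩)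

/-- **Two-step programs**: the real value is at most `e2` at the real options and the coarse class read on the
(unchanged) idle side copy. [this work] -/
theorem P2.val_le {q : P2} (hq : q.wfT = true) :
    q.val τ c x ≤ e2 c (ftype τ (x 0)) q (st τ x q.T1 (rep (ftype τ (x 0)) q.u)) (ftype τ (x q.T2))
      (st τ x q.T2 (rep (ftype τ (x 0)) q.v)) (c.cls2 (ftype τ (x q.idl))) := by
  have hne := P2.idl_ne hq
  have hid : q.prog.out τ x q.idl = x q.idl := Prog.out_idle τ x q.prog hne.1 hne.2.1 (fun _ => hne.2.2)
  unfold P2.val P2.ev e2 e2T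
  beta_reduce
  rw [hid]
  refine le_lmax (List.mem_flatMap.2 ⟨c.cls (ftype τ (q.prog.out τ x q.T1)), ?_,
    List.mem_map.2 ⟨c.cls (ftype τ (q.prog.out τ x q.T2)), ?_, rfl⟩⟩)
  · unfold cleanC
    refine List.mem_dedup.2 (List.mem_map.2 ⟨_, ?_, rfl⟩)
    rw [show q.prog.out τ x q.T1 = splice (touch (clS (x 0) (roots τ {q.u}))) (x 0) (x q.T1) from
      Prog.out_first τ x (P2.prog_wf hq)]
    exact ftype_first_mem_cleanL τ (x 0) (x q.T1) q.u
  · unfold messyC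
    refine List.mem_dedup.2 (List.mem_map.2 ⟨_, ?_, rfl⟩)
    rw [show q.prog.out τ x q.T2 = splice (touch (clS (x 0) (roots τ {q.v})) \ touch (clS (x 0) (roots τ {q.u})))
        (x 0) (x q.T2) from Prog.out_second τ x (P2.prog_wf hq) rfl]
    exact ftype_second_mem_messyL τ (x 0) (x q.T2) q.u q.v

/-- `e2g = e2` at the real options. [this work] -/
theorem e2g_st (q : P2) (j k : Fin 4) (t : Ty) (a : ℕ) :
    e2g c (ftype τ (x 0)) q (st τ x j (rep (ftype τ (x 0)) q.u)) t (st τ x k (rep (ftype τ (x 0)) q.v)) a =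
      e2 c (ftype τ (x 0)) q (st τ x j (rep (ftype τ (x 0)) q.u)) t (st τ x k (rep (ftype τ (x 0)) q.v)) a := by
  rw [e2g, relB_st, relB_st, Bool.true_and, if_pos rfl]

/-! ### The hub bound -/

/-- Sum of casts. [folklore] -/
theorem sum_map_natCast {α : Type} (L : List α) (g : α → ℕ) :
    ((L.map fun a => (g a : ℤ)).sum) = ((L.map g).sum : ℤ) := by
  induction L with
  | nil => simp
  | cons a L ih => simp [ih]

/-- Termwise bounds add up, with a constant per term. [folklore] -/
theorem sum_add_length_mul_le {α : Type} (L : List α) (f : α → ℤ) (g : α → ℕ) (C : ℤ)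
    (h : ∀ a ∈ L, f a + C ≤ (g a : ℤ)) : (L.map f).sum + L.length * C ≤ (L.map fun a => (g a : ℤ)).sum := by
  induction L with
  | nil => simp
  | cons a L ih =>
    simp only [List.map_cons, List.sum_cons, List.length_cons, Nat.cast_add, Nat.cast_one]
    have h1 := h a List.mem_cons_self
    have h2 := ih fun b hb => h b (List.mem_cons_of_mem _ hb)
    linarith

variable {c}

/-- **Hub bound.**  The one-step programs into the hub are bounded by the stored hub value at the classes of the two
side types, minus the offsets. [this work] -/
theorem hub_le (hc : c.ok = true) :
    ((c.one.filter fun q => q.T = 3).map fun q => q.val τ c x).sum ≤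
      lk (lk ((mkSlice c (mkPiTabs c (ftype τ (x 0))) (ftype τ (x 3))).hubT (st τ x 3)) (c.cls (ftype τ (x 1))) [])
        (c.cls (ftype τ (x 2))) bot := by
  have hwf : c.wf = true := by simp only [Cert.ok, Bool.and_eq_true] at hc; exact hc.1
  have hb : c.bounded = true := by simp only [Cert.ok, Bool.and_eq_true] at hc; exact hc.2
  set πX := ftype τ (x 0)
  set a := c.cls (ftype τ (x 1)) with ha
  set b := c.cls (ftype τ (x 2)) with hb'
  have ha' : a < c.ncls := cls_lt hb _
  have hb'' : b < c.ncls := cls_lt hb _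
  have hhub : (mkSlice c (mkPiTabs c πX) (ftype τ (x 3))).hub =
      (c.one.filter fun q => q.T = 3).map fun q => (x1hub (CTab c πX) c.ncls q, rep πX q.u) := by
    simp only [mkSlice, P1s_eq, CT_eq, List.filter_map, List.map_map]
    rfl
  have hnc : (mkSlice c (mkPiTabs c πX) (ftype τ (x 3))).nc = c.ncls := rfl
  rw [Slice.hubT, hnc, lk_map_range _ _ ha', lk_map_range _ _ hb'', hhub, List.map_map, List.length_map]
  simp only [Function.comp_def]
  have key : ∀ q ∈ c.one.filter (fun q => q.T = 3),
      q.val τ c x + OFF ≤ ((digW (lk (x1hub (CTab c πX) c.ncls q) (c.ncls * a + b) 0) (st τ x 3 (rep πX q.u)).val : ℕ) : ℤ) := by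
    intro q hq
    have hq1 : q ∈ c.one := List.mem_of_mem_filter hq
    have hT : q.T = 3 := by simpa using (List.mem_filter.1 hq).2
    have hqwf : q.wf = true := by
      simp only [Cert.wf, Bool.and_eq_true, List.all_eq_true] at hwf; exact hwf.1 q hq1
    have hna : a < q.na c := by rw [P1.na, if_pos hT]; exact ha'
    rw [x1hub_lk c πX q ha' hb'', digW_eq, pvec,
      dig_pvecN (fun q' => lt_trans (enc_lt (e1_lt hb hq1 πX q' hna hb'')) (by decide))]
    have hv := P1.val_le τ c x hqwf
    simp only [hT, if_true] at hv
    exact add_OFF_le_enc hv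
  have := sum_add_length_mul_le _ (fun q : P1 => q.val τ c x) _ OFF key
  rw [sum_map_natCast] at this
  linarith

/-- **Fibre bound.**  The programs with side copy `T` and side root in the block of `w` are bounded by the decoded
column of the fibre at the coarse class of the other side type and the side base type. [this work] -/
theorem fibre_le (hc : c.ok = true) (T w : Fin 4) (hT3 : T ≠ 3) :
    ((onef c (ftype τ (x 0)) T w).map fun q => q.val τ c x).sum
      + ((sff c (ftype τ (x 0)) T w).map fun q => q.val τ c x).sum
      + ((hff c (ftype τ (x 0)) T w).map fun q => q.val τ c x).sum ≤
    lk (lk ((mkFib c (mkPiTabs c (ftype τ (x 0))) (ftype τ (x 3)) T w).colZ c.ncl2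
          (lk (mkSlice c (mkPiTabs c (ftype τ (x 0))) (ftype τ (x 3))).OP w.val []) (st τ x 3)) (c.cls2 (ftype τ (x (oth T)))) [])
      (ftype τ (x T)).val 0 := by
  have hwf : c.wf = true := by simp only [Cert.ok, Bool.and_eq_true] at hc; exact hc.1
  have hb : c.bounded = true := by simp only [Cert.ok, Bool.and_eq_true] at hc; exact hc.2
  set πX := ftype τ (x 0) with hπX
  set t3 := ftype τ (x 3) with ht3
  set tT := ftype τ (x T) with htT
  set s3 := st τ x 3 with hs3
  set p := st τ x T w with hp
  set a := c.cls2 (ftype τ (x (oth T))) with ha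
  have ha' : a < c.ncl2 := cls2_lt hb _
  have hc3 : c.cls t3 < c.ncls := cls_lt hb _
  -- the option positions of letter `w`
  have hOP : lk (mkSlice c (mkPiTabs c πX) t3).OP w.val [] = allTys.map fun t => (optsF πX t w).map fun q => q.val := by
    simp only [mkSlice, lk_map_finRange4, opts_eq]
  have hlenA : a < ((mkFib c (mkPiTabs c πX) t3 T w).col c.ncl2 (allTys.map fun t => (optsF πX t w).map fun q => q.val) s3).length := by
    rw [length_col]; exact ha'
  rw [hOP, Fib.colZ, lk_map_of_lt _ _ _ hlenA [] [],
    lk_map_of_lt _ (fun n : ℕ => (↑n : ℤ) - (mkFib c (mkPiTabs c πX) t3 T w).size * OFF) _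
      (by rw [length_of_mem_col _ _ _ _ (lk_mem_of_lt _ hlenA [])]; exact tT.isLt) 0 0,
    lk_col _ _ _ _ ha']
  -- the three program lists and their sizes
  have h1 := F_one_eq c πX t3 T w
  have h2 := F_sf_eq c πX t3 T w
  have h3 := F_hf_eq c πX t3 T w
  have hsize : (mkFib c (mkPiTabs c πX) t3 T w).size = (onef c πX T w).length + (sff c πX T w).length + (hff c πX T w).length := by
    simp only [Fib.size, h1, h2, h3, List.length_map]
  -- membership facts
  have mem1 : ∀ q ∈ onef c πX T w, q ∈ c.one ∧ q.T = T ∧ rep πX q.u = w := fun q hq => by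
    have h := List.mem_filter.1 hq; exact ⟨h.1, by simpa using h.2⟩
  have mem2 : ∀ q ∈ sff c πX T w, q ∈ c.two ∧ q.T2 = 3 ∧ q.T1 = T ∧ rep πX q.u = w := fun q hq => by
    have h := List.mem_filter.1 hq; exact ⟨h.1, by simpa using h.2⟩
  have mem3 : ∀ q ∈ hff c πX T w, q ∈ c.two ∧ q.T1 = 3 ∧ q.T2 = T ∧ rep πX q.v = w := fun q hq => by
    have h := List.mem_filter.1 hq; exact ⟨h.1, by simpa using h.2⟩
  have wf1 : ∀ q ∈ c.one, q.wf = true := by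
    simp only [Cert.wf, Bool.and_eq_true, List.all_eq_true] at hwf; exact hwf.1
  have wf2 : ∀ q ∈ c.two, q.wf = true := by
    simp only [Cert.wf, Bool.and_eq_true, List.all_eq_true] at hwf; exact hwf.2
  -- the three entry functions
  let g1 : P1 → Ty → ℕ := fun q p' => enc (e1 c πX q p' a (c.cls t3))
  let g2 : P2 → Ty → ℕ := fun q p' => enc (e2g c πX q p' t3 (s3 (rep πX q.v)) a)
  let g3 : P2 → Ty → ℕ := fun q p' => enc (e2g c πX q (s3 (rep πX q.u)) tT p' a)
  have hg1 : ∀ q ∈ onef c πX T w, ∀ p', g1 q p' < DMAX := fun q hq p' =>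
    enc_lt (e1_lt hb (mem1 q hq).1 _ _ (by rw [P1.na, (mem1 q hq).2.1, if_neg hT3]; exact ha') hc3)
  have hg2 : ∀ q ∈ sff c πX T w, ∀ p', g2 q p' < DMAX := fun q hq p' => enc_lt (e2g_lt hb (mem2 q hq).1 _ _ _ _ ha')
  have hg3 : ∀ q ∈ hff c πX T w, ∀ p', g3 q p' < DMAX := fun q hq p' => enc_lt (e2g_lt hb (mem3 q hq).1 _ _ _ _ ha')
  -- rewrite the three packed parts
  have e_one : ((mkFib c (mkPiTabs c πX) t3 T w).one.map fun e => lk e a 0).sum = ((onef c πX T w).map fun q => pvecN (g1 q)).sum := by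
    rw [h1, List.map_map]
    refine congrArg List.sum (List.map_congr_left fun q _ => ?_)
    show lk (x1side (CTab c πX) c.ncl2 (c.cls t3) q) a 0 = pvecN (g1 q)
    rw [x1side_lk c πX q _ ha']; rfl
  have e_sf : ((mkFib c (mkPiTabs c πX) t3 T w).sf.map fun e => lk (lk e.1 a []) (s3 e.2).val 0).sum =
      ((sff c πX T w).map fun q => pvecN (g2 q)).sum := by
    rw [h2, List.map_map]
    refine congrArg List.sum (List.map_congr_left fun q hq => ?_)
    show lk (lk (xsfOf (mkPiTabs c πX) c.ncl2 t3 q) a []) (s3 (rep πX q.v)).val 0 = pvecN (g2 q)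
    rw [xsf_lk c πX t3 q ha' _ (by rw [hs3]; exact relB_st τ x 3 q.v)]; rfl
  have e_hf : ((mkFib c (mkPiTabs c πX) t3 T w).hf.map fun e => lk (lk e.1 a []) (s3 e.2).val 0).sum =
      ((hff c πX T w).map fun q => packL BV (allTys.map fun t' => pvecN fun p' =>
        enc (e2g c πX q (s3 (rep πX q.u)) t' p' a))).sum := by
    rw [h3, List.map_map]
    refine congrArg List.sum (List.map_congr_left fun q hq => ?_)
    show lk (lk (xhfT c πX q) a []) (s3 (rep πX q.u)).val 0 = _
    rw [xhf_lk c πX q (mem3 q hq).2.1 ha' _ (by rw [hs3]; exact relB_st τ x 3 q.u)]; rfl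
  have e_tot : digV (((mkFib c (mkPiTabs c πX) t3 T w).hf.map fun e => lk (lk e.1 a []) (s3 e.2).val 0).sum) tT.val =
      ((hff c πX T w).map fun q => pvecN (g3 q)).sum := by
    rw [e_hf, digV_eq]
    exact dig_sum_rows (hff c πX T w) (fun q t' => pvecN fun p' => enc (e2g c πX q (s3 (rep πX q.u)) t' p' a))
      (fun q hq t' => pvecN_lt_HEAD fun p' => enc_lt (e2g_lt hb (mem3 q hq).1 _ _ _ _ ha'))
      (lt_of_le_of_lt (List.length_filter_le _ _) (by have := size_lt hb; omega)) tT
  -- the packed vector of the fibre and its digit at the real option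
  have e_vec : ((mkFib c (mkPiTabs c πX) t3 T w).one.map fun e => lk e a 0).sum +
      ((mkFib c (mkPiTabs c πX) t3 T w).sf.map fun e => lk (lk e.1 a []) (s3 e.2).val 0).sum +
      digV (((mkFib c (mkPiTabs c πX) t3 T w).hf.map fun e => lk (lk e.1 a []) (s3 e.2).val 0).sum) tT.val =
      pvecN (fun p' => ((onef c πX T w).map fun q => g1 q p').sum + ((sff c πX T w).map fun q => g2 q p').sum +
        ((hff c πX T w).map fun q => g3 q p').sum) := by
    rw [e_one, e_sf, e_tot, sum_map_pvecN, sum_map_pvecN, sum_map_pvecN, pvecN_add, pvecN_add]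
  have hdig : digW (((mkFib c (mkPiTabs c πX) t3 T w).one.map fun e => lk e a 0).sum +
      ((mkFib c (mkPiTabs c πX) t3 T w).sf.map fun e => lk (lk e.1 a []) (s3 e.2).val 0).sum +
      digV (((mkFib c (mkPiTabs c πX) t3 T w).hf.map fun e => lk (lk e.1 a []) (s3 e.2).val 0).sum) tT.val) p.val =
      ((onef c πX T w).map fun q => g1 q p).sum + ((sff c πX T w).map fun q => g2 q p).sum +
        ((hff c πX T w).map fun q => g3 q p).sum := by
    rw [e_vec, digW_eq]
    refine dig_pvecN (fun q' => ?_) p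
    have b1 : ((onef c πX T w).map fun q => g1 q q').sum ≤ (onef c πX T w).length * DMAX := by
      have := List.sum_le_sum (l := onef c πX T w) (f := fun q => g1 q q') (g := fun _ => DMAX)
        fun q hq => (hg1 q hq q').le
      simpa using this
    have b2 : ((sff c πX T w).map fun q => g2 q q').sum ≤ (sff c πX T w).length * DMAX := by
      have := List.sum_le_sum (l := sff c πX T w) (f := fun q => g2 q q') (g := fun _ => DMAX)
        fun q hq => (hg2 q hq q').le
      simpa using this
    have b3 : ((hff c πX T w).map fun q => g3 q q').sum ≤ (hff c πX T w).length * DMAX := by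
      have := List.sum_le_sum (l := hff c πX T w) (f := fun q => g3 q q') (g := fun _ => DMAX)
        fun q hq => (hg3 q hq q').le
      simpa using this
    have l1 : (onef c πX T w).length ≤ c.one.length := List.length_filter_le _ _
    have l2 : (sff c πX T w).length ≤ c.two.length := List.length_filter_le _ _
    have l3 : (hff c πX T w).length ≤ c.two.length := List.length_filter_le _ _
    have hs := size_lt hb
    calc _ ≤ ((onef c πX T w).length + (sff c πX T w).length + (hff c πX T w).length) * DMAX := by nlinarith
      _ < 2048 * DMAX := Nat.mul_lt_mul_of_lt_of_le (by omega) le_rfl (by decide)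
      _ = BW := by decide
  -- the real option is among the scanned positions
  have hmax : digW (((mkFib c (mkPiTabs c πX) t3 T w).one.map fun e => lk e a 0).sum +
      ((mkFib c (mkPiTabs c πX) t3 T w).sf.map fun e => lk (lk e.1 a []) (s3 e.2).val 0).sum +
      digV (((mkFib c (mkPiTabs c πX) t3 T w).hf.map fun e => lk (lk e.1 a []) (s3 e.2).val 0).sum) tT.val) p.val ≤
      nmax (((optsF πX tT w).map fun q => q.val).map fun pp => digW (((mkFib c (mkPiTabs c πX) t3 T w).one.map fun e => lk e a 0).sum +
        ((mkFib c (mkPiTabs c πX) t3 T w).sf.map fun e => lk (lk e.1 a []) (s3 e.2).val 0).sum +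
        digV (((mkFib c (mkPiTabs c πX) t3 T w).hf.map fun e => lk (lk e.1 a []) (s3 e.2).val 0).sum) tT.val) pp) :=
    le_nmax (List.mem_map.2 ⟨p.val, List.mem_map.2 ⟨p, by rw [hp, htT]; exact st_mem_optsF τ x T w, rfl⟩, rfl⟩)
  -- termwise bounds
  have k1 : ∀ q ∈ onef c πX T w, q.val τ c x + OFF ≤ (g1 q p : ℤ) := fun q hq => by
    obtain ⟨hq1, hT, hw⟩ := mem1 q hq
    have hv := P1.val_le τ c x (wf1 q hq1)
    rw [hT, hw, if_neg hT3, if_neg hT3] at hv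
    exact add_OFF_le_enc hv
  have k2 : ∀ q ∈ sff c πX T w, q.val τ c x + OFF ≤ (g2 q p : ℤ) := fun q hq => by
    obtain ⟨hq2, hT2, hT1, hw⟩ := mem2 q hq
    have hv := P2.val_le τ c x (P2.wfT_of_wf (wf2 q hq2))
    have hidl : q.idl = oth T := P2.idl_sf hT1 hT2 hT3
    have he := e2g_st τ c x q T 3 t3 a
    rw [hT1, hT2, hw, hidl] at hv
    rw [hw] at he
    show q.val τ c x + OFF ≤ (enc (e2g c πX q p t3 (s3 (rep πX q.v)) a) : ℤ)
    rw [hp, hs3, he]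
    exact add_OFF_le_enc hv
  have k3 : ∀ q ∈ hff c πX T w, q.val τ c x + OFF ≤ (g3 q p : ℤ) := fun q hq => by
    obtain ⟨hq2, hT1, hT2, hw⟩ := mem3 q hq
    have hv := P2.val_le τ c x (P2.wfT_of_wf (wf2 q hq2))
    have hidl : q.idl = oth T := P2.idl_hf hT1 hT2 hT3
    have he := e2g_st τ c x q 3 T tT a
    rw [hT1, hT2, hw, hidl] at hv
    rw [hw] at he
    show q.val τ c x + OFF ≤ (enc (e2g c πX q (s3 (rep πX q.u)) tT p a) : ℤ)
    rw [hp, hs3, he]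
    exact add_OFF_le_enc hv
  have S1 := sum_add_length_mul_le _ (fun q : P1 => q.val τ c x) _ OFF k1
  have S2 := sum_add_length_mul_le _ (fun q : P2 => q.val τ c x) _ OFF k2
  have S3 := sum_add_length_mul_le _ (fun q : P2 => q.val τ c x) _ OFF k3
  rw [sum_map_natCast] at S1 S2 S3
  rw [hsize]
  have hdigZ : ((digW (((mkFib c (mkPiTabs c πX) t3 T w).one.map fun e => lk e a 0).sum +
      ((mkFib c (mkPiTabs c πX) t3 T w).sf.map fun e => lk (lk e.1 a []) (s3 e.2).val 0).sum +
      digV (((mkFib c (mkPiTabs c πX) t3 T w).hf.map fun e => lk (lk e.1 a []) (s3 e.2).val 0).sum) tT.val) p.val : ℕ) : ℤ) =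
      (((onef c πX T w).map fun q => g1 q p).sum : ℤ) + (((sff c πX T w).map fun q => g2 q p).sum : ℤ) +
        (((hff c πX T w).map fun q => g3 q p).sum : ℤ) := by
    rw [hdig]; push_cast; ring
  have hmaxZ := Int.ofNat_le.2 hmax
  push_cast at hmaxZ ⊢
  rw [hdigZ] at hmaxZ
  linarith

end Real

end FourCopyHub

end Summit.CriticalPhenomena.PercolationContinuityZ3.Theorems

end
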